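import Summits.FinalStateConjecture.FinalStateConjecture.Theses.StarvedNecks
import Summits.FinalStateConjecture.FinalStateConjecture.Theses.SwallowTheDatum
import Literature.Geometry.Lorentzian.KerrDataProofs
import Literature.Geometry.Lorentzian.KerrSchildCoord

/-!
# Crux `HonestFixedRadiusSettling` (stmt-FinalStateConjecture-13550) — ideator 2 sketch (round 1)

Two first lemmas, one per idea card, over existing declarations only.

* Card `bury-it-honestly`: `KerrShielded` (verbatim the shielding predicate of
  `SwallowTheDatum.KerrShieldedSettles`, stmt-10054), `KerrShieldedHonest` (the C⁴ / honest
  analogue of `KerrShieldedSettles`: a Kerr-shielded admissible datum satisfies the `∀`-MGHD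
  conjunct of THIS crux's property, with `HonestCore ∧ HonestFar` copied verbatim from the crux),
  and the kernel-checked reduction
  `honestFixedRadiusSettling_of_burial : ParametricKerrBurial → MGHDExists → KerrShieldedHonest →
  HonestFixedRadiusSettling` (the crux BY NAME).
* Card `horizon-clocks`: `ClockAnchoring` — a late chart whose domain carries a forward-complete
  clock flow (chart time advances at unit rate, chart radius is preserved) with future-directed
  causal push-forward satisfies the anchoring clause (HonestCore, clause 2) for every radius and
  every pair of chart times.
-/

noncomputable section

open Literature.Geometry.Lorentzian
open scoped Manifold ContDiff Topology ENNReal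
open Filter Set

namespace Summit.FinalStateConjecture.FinalStateConjecture.Cruxes.HonestFixedRadiusSettling.SketchIdeator2

/-- The datum `D` on `X` is **Kerr-shielded**: verbatim the hypothesis of
`Theses.SwallowTheDatum.KerrShieldedSettles` (stmt-FinalStateConjecture-10054) — outside a compact
set it is an exact bent Kerr–Schild/Boyer–Lindquist slice of a sub-extremal Kerr entering the
black hole down to a junction radius `r₁ ∈ (r₋, r₊)`. -/
def KerrShielded [Literature.Geometry.Lorentzian.Kerr.Facts] (X : Type) [TopologicalSpace X]
    [ChartedSpace Literature.Geometry.Lorentzian.E3 X]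
    [IsManifold (𝓡 3) ((⊤ : ℕ∞) : WithTop ℕ∞) X]
    (D : Literature.Geometry.Lorentzian.InitialDataSet (𝓡 3) X) : Prop :=
  ∃ (M a r₁ : ℝ) (hM : 0 ≤ M) (T : ℝ → ℝ) (φ : Literature.Geometry.Lorentzian.Kerr.slice a r₁ → X) (ψ : Literature.Geometry.Lorentzian.Kerr.slice a r₁ → Literature.Geometry.Lorentzian.Kerr.region a r₁) (ν : Literature.Geometry.Lorentzian.NormalField 𝓘(ℝ, Literature.Geometry.Lorentzian.E4) ψ), |a| < M ∧ Literature.Geometry.Lorentzian.Kerr.rMinus M a < r₁ ∧ r₁ < Literature.Geometry.Lorentzian.Kerr.rPlus M a ∧ T = (fun r : ℝ => Real.smoothTransition (r / (4 * M) - 1) * (((M) / Real.sqrt ((M) ^ 2 - (a) ^ 2)) * (Literature.Geometry.Lorentzian.Kerr.rPlus M a * Real.log (r - Literature.Geometry.Lorentzian.Kerr.rPlus M a) - Literature.Geometry.Lorentzian.Kerr.rMinus M a * Real.log (r - Literature.Geometry.Lorentzian.Kerr.rMinus M a)) - ((M) / Real.sqrt ((M) ^ 2 - (a) ^ 2)) *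 (Literature.Geometry.Lorentzian.Kerr.rPlus M a * Real.log ((4 * M) - Literature.Geometry.Lorentzian.Kerr.rPlus M a) - Literature.Geometry.Lorentzian.Kerr.rMinus M a * Real.log ((4 * M) - Literature.Geometry.Lorentzian.Kerr.rMinus M a)))) ∧ IsCompact (Set.range φ)ᶜ ∧ Topology.IsOpenEmbedding φ ∧ ContMDiff 𝓘(ℝ, Literature.Geometry.Lorentzian.E3) (𝓡 3) ((⊤ : ℕ∞) : WithTop ℕ∞) φ ∧ (∀ y : Literature.Geometry.Lorentzian.Kerr.slice a r₁, (ψ y : Literature.Geometry.Lorentzian.E4) = Literature.Geometry.Lorentzian.E4.ofTimeSpace (T (Literature.Geometry.Lorentzian.Kerr.radius a (Literature.Geometry.Lorentzian.E4.ofTimeSpace 0 (y : Literature.Geometry.Lorentzian.E3)))) (y : Literature.Geometry.Lorentzian.E3)) ∧ (Literature.Geometry.Lorentzian.Kerr.smoothMetric M a r₁).IsSpacelikeImmersion 𝓘(ℝ, Literature.Geometry.Lorentzian.E3) ψ ∧ (Literature.Geometry.Lorentzian.Kerr.smoothMetric M a r₁).IsFutureUnitNormal 𝓘(ℝ, Literature.Geometry.Lorentzian.E3)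 ((Literature.Geometry.Lorentzian.Kerr.timeOrientation M a r₁ hM).ofLE le_top) ψ ν ∧ (∀ y : Literature.Geometry.Lorentzian.Kerr.slice a r₁, Literature.Geometry.Lorentzian.pullbackBilin (I := 𝓡 3) (I' := 𝓘(ℝ, Literature.Geometry.Lorentzian.E3)) φ (D).h.inner y = Literature.Geometry.Lorentzian.pullbackBilin (I := 𝓘(ℝ, Literature.Geometry.Lorentzian.E4)) (I' := 𝓘(ℝ, Literature.Geometry.Lorentzian.E3)) ψ (Literature.Geometry.Lorentzian.Kerr.smoothMetric M a r₁).val y) ∧ (∀ [(Literature.Geometry.Lorentzian.Kerr.smoothMetric M a r₁).HasLeviCivita] (y : Literature.Geometry.Lorentzian.Kerr.slice a r₁), (Literature.Geometry.Lorentzian.pullbackBilin (I := 𝓡 3) (I' := 𝓘(ℝ, Literature.Geometry.Lorentzian.E3)) φ (D).k y).toLinearMap₁₂ = (Literature.Geometry.Lorentzian.Kerr.smoothMetric M a r₁).secondFundamentalForm 𝓘(ℝ, Literature.Geometry.Lorentzian.E3) ψ ν y)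

/-- **KerrShieldedHonest** (card `bury-it-honestly`, the transfer target `C⁺`): a Kerr-shielded
admissible datum satisfies the `∀`-MGHD conjunct of the crux property of
`StarvedNecks.HonestFixedRadiusSettling` — complete `𝓘⁺` (sojourn form) and an HONEST `C⁴`
fixed-radius decomposition (`HonestCore ∧ HonestFar`, the two `let`-blocks copied verbatim from the
crux) of `O = exteriorOf`. Intended witness: `N = 1`, the exact Kerr of the shield, hole chart =
ingoing Kerr–Schild coordinates slowly UNBENT from the Boyer–Lindquist height (monotone clock
`∂_t β > −1`), flat chart = Boyer–Lindquist-time Kerr–Schild-space coordinates outside a slowly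
growing tube; deviation `≡ 0` on every fixed-radius slab eventually. -/
def KerrShieldedHonest : Prop :=
  open Literature.Geometry.Lorentzian in open scoped ContDiff ENNReal in let Hc := ( fun (𝓢 : Spacetime.{0} 4) (O : Set 𝓢.carrier) (k : ℕ) (d : FinalStateDecomposition 𝓢 O k) (R₀ : ℝ) => let B := d.background; let t := fun i ↦ (B i).time; let r := fun i ↦ (B i).radius; let Ψ := d.chart; (∀ i, Kerr.IsSubextremal (d.mass i) (d.spin i) ∧ 100 * d.mass i ≤ R₀ ∧ 0 < ((d.motion i).1 : E4 ≃L[ℝ] E4) (E4.basisVector 0) 0) ∧ (∀ i (ϱ τ₂ : ℝ), R₀ ≤ ϱ → d.τ₀ < τ₂ → Ψ i '' {x | d.τ₀ < t i x.1 ∧ t i x.1 < τ₂ ∧ r i x.1 < ϱ} ⊆ 𝓢.metric.causalPast 𝓢.timeOrientation (Ψ i '' (B i).truncTimeSlab ϱ τ₂)) ∧ (∀ i (τ' : ℝ) (ϱ : ℝ → ℝ), Continuous ϱ → d.τ₀ < τ' → let A := Ψ i '' {x | τ' ≤ t i x.1 ∧ r i x.1 ≤ ϱ (t i x.1)}; closure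 A ∩ O ⊆ A) ∧ (∀ y : d.flatDomain, d.τ₀ < y.1 0 → 𝓢.timeOrientation.IsFutureDirected (mfderiv 𝓘(ℝ, E4) (𝓡 4) d.flatChart y (E4.basisVector 0))) ); let Hf := ( fun (𝓢 : Spacetime.{0} 4) (O : Set 𝓢.carrier) (k : ℕ) (d : FinalStateDecomposition 𝓢 O k) (R₀ : ℝ) => let B := d.background; let t := fun i ↦ (B i).time; let r := fun i ↦ (B i).radius; let Φ := d.flatChart; (∀ τ₂ : ℝ, d.τ₀ < τ₂ → Φ '' {y | d.τ₀ < y.1 0 ∧ y.1 0 < τ₂} ⊆ 𝓢.metric.causalPast 𝓢.timeOrientation (Φ '' (Minkowski.backgroundOn d.flatDomain).timeSlab τ₂)) ∧ (∀ τ' : ℝ, d.τ₀ < τ' → closure (Φ '' {y | τ' ≤ y.1 0 ∧ ∀ i, d.excision i (y.1 0) + 1 ≤ r i y.1}) ⊆ Φ '' {y | τ' ≤ y.1 0}) ∧ (∀ i, ∃ T : ℝ, supCkENorm (Subtype.val '' {x : (B i).domain | T ≤ t i x.1 ∧ R₀ ≤ r i x.1 ∧ ∀ j, j ≠ i → r i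 x.1 ≤ r j x.1}) 0 (𝓢.deviationExtend (B i) (d.chart i)) ≤ ENNReal.ofReal (1 / (10 * ‖(((d.motion i).1 : E4 ≃L[ℝ] E4) : E4 →L[ℝ] E4)‖ ^ 2))) ); ∀ [Literature.Geometry.Lorentzian.Kerr.Facts], ∀ (X : Type) [TopologicalSpace X] [ChartedSpace E3 X] [IsManifold (𝓡 3) ∞ X] [T2Space X] [SecondCountableTopology X] [ConnectedSpace X], ∀ D ∈ admissibleVacuumData X, KerrShielded X D → ∀ 𝒟 : VacuumCauchyDevelopment D, 𝒟.IsMaximal → HasCompleteNullInfinity 𝒟.toCauchyDevelopment ∧ ∃ (O : Set 𝒟.carrier) (d : FinalStateDecomposition 𝒟.toSpacetime O 4) (R₀ : ℝ), O = exteriorOf 𝒟.toCauchyDevelopment d.charted ∧ Hc 𝒟.toSpacetime O 4 d R₀ ∧ Hf 𝒟.toSpacetime O 4 d R₀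

/-- **Reduction (kernel-checked): the crux from SwallowTheDatum's burial plus honest exact Kerr.**
`ParametricKerrBurial` (stmt-10052) hands, through every admissible datum, a jointly smooth
injective admissible family all of whose `c ≠ 0` members are Kerr-shielded; `MGHDExists`
(stmt-9937) gives the `∃`-MGHD conjunct and `KerrShieldedHonest` the `∀`-MGHD conjunct of the crux
property for those members; Christodoulou codimension `1` follows by unfolding
`IsChristodoulouGeneric`/`HasCodimAtLeastIn`. The `Kerr.Facts` instance is built from the tree's three
discharged facts (as in `Theorems.SwallowTheDatum.kerrFacts`). -/
theorem honestFixedRadiusSettling_of_burial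
    (hB : Theses.SwallowTheDatum.ParametricKerrBurial)
    (hM : Theses.SwallowTheDatum.MGHDExists)
    (hH : KerrShieldedHonest) :
    Theses.StarvedNecks.HonestFixedRadiusSettling := by
  intro X _ _ _ _ _ _ d hd
  haveI : Kerr.Facts :=
    ⟨Kerr.isConnected_region_holds, Kerr.contMDiff_bilin_holds, Kerr.contMDiff_timeVector_holds⟩
  obtain ⟨F, hF, h0, hinj, hadm, hshield⟩ := hB X d hd.1
  refine ⟨F, hF, h0, hinj, hadm, fun c hc hc' ↦ hc'.2 ?_⟩
  exact ⟨hM X (F c) (hadm c), hH X (F c) (hadm c) (hshield c hc)⟩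

/-- **ClockAnchoring** (card `horizon-clocks`, first lemma). Let `Ψ` be a late chart of the model
background `B` into the region `O` of the spacetime `𝓢` after chart time `τ₀`. Suppose the late
chart domain carries a CLOCK FLOW: through every late domain point `x` and for every `s ≥ 0` a
curve `γ : [0, s] → B.domain` with `γ 0 = x`, tangent to a fixed coordinate vector field `W`,
along which the chart time advances at unit rate and the chart radius is constant, and whose
image `Ψ ∘ γ` is a future-directed causal curve of `𝓢` (for boosted Kerr: `W = Λ(∂_t* + Ω(r)∂_φ*)`,
the twisted Killing clock, timelike on the whole exterior for a suitable cut-off `Ω`; in a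
spacetime `C⁰`-close to it on the relevant region the push-forward stays timelike). Then the
ANCHORING clause (HonestCore, clause 2) holds for `Ψ` at every radius `ϱ ≥ R₀` and all chart times
`τ₀ < t < τ₂`: earlier charted points of `{r < ϱ}` lie in `J⁻` of the truncated slab
`{t = τ₂, r ≤ ϱ}`. Pure Lorentzian causality over `Causality.lean`. -/
def ClockAnchoring : Prop :=
  ∀ (𝓢 : Spacetime.{0} 4) (B : ModelBackground) (O : Set 𝓢.carrier) (τ₀ R₀ : ℝ)
    (Ψ : B.domain → 𝓢.carrier) (W : E4 → E4), 𝓢.IsLateChart B O τ₀ Ψ →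
    (∀ x : B.domain, τ₀ < B.time x.1 → ∀ s : ℝ, 0 ≤ s →
      ∃ γ : ℝ → B.domain, γ 0 = x ∧ ∀ σ ∈ Icc (0 : ℝ) s,
        HasDerivAt (fun σ' : ℝ ↦ ((γ σ' : B.domain) : E4)) (W (γ σ).1) σ ∧
        B.time (γ σ).1 = B.time x.1 + σ ∧ B.radius (γ σ).1 = B.radius x.1) →
    (∀ x : B.domain, τ₀ < B.time x.1 →
      𝓢.timeOrientation.IsFutureDirected (mfderiv 𝓘(ℝ, E4) (𝓡 4) Ψ x (W x.1))) →
    ∀ (ϱ τ₂ : ℝ), R₀ ≤ ϱ → τ₀ < τ₂ →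
      Ψ '' {x | τ₀ < B.time x.1 ∧ B.time x.1 < τ₂ ∧ B.radius x.1 < ϱ} ⊆
        𝓢.metric.causalPast 𝓢.timeOrientation (Ψ '' B.truncTimeSlab ϱ τ₂)

end Summit.FinalStateConjecture.FinalStateConjecture.Cruxes.HonestFixedRadiusSettling.SketchIdeator2

end
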